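import Summits.Ventures.PercRepro.Night2T4Facts
import Summits.Ventures.PercRepro.GenQSevenFiveColoopFree

/-!
# PercRepro — the trace sums of `(7, 5)` in the cyclic-rank profile (night-2, gen 4)

`SevenFiveTraceSumsCore` (night-4, `GenQSevenFiveColoopFree`) asks, on every rank-`4` subset `H` of a rank-`7` Core
matroid and every `t ∈ {2, 3, 4}`, the TRACE SUM `TS_t(H) = Σ_{B ∈ R_4(H)} ((7 − t)/(2 + m(B)) − (7/6)·dem_t(B)) ≥ 0`
(the `(7, 5)` balance of `H ∪ {a}`, `a` a coloop, read on `H`).  This file is its Lean side in the profile: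

* `traceSum_mul_six_eq_profile`: `6·TS_t = 7·DF_t + Σ_k Σ_m #Pc k m · (6(7 − t)/(2 + m) − 7)` — the trace objective of
  the profile LP (`mining/night-2/g4/leanlp_t.py`, `TRACE = True`);
* `sum_card_Pc_le_DFq_two`: the levels `0, 1` are demand-free at type `2` (the type-`3` and `4` versions are
  `sum_card_Pc_le_DFq` / `sum_card_Pc_le_DFq_four`);
* `traceSum_nonneg_of_card_le`: at corank `≤ t − 1` every set is demand-free, so `TS_t ≥ 0` outright;
* the sizes of a rank-`4` subset of the core by its coloop count: `card_le_one_of_eRk_le_one` (a set of rank `≤ 1` of a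
  simple matroid has `≤ 1` point), `card_le_of_mTr` (`|H| ≤ m(H) + f(4 − m(H))`: `≤ 1 + 6` at `m = 1`, `≤ 2 + 3` at
  `m = 2`, `≤ 4` at `m = 3`, `≤ 5` at `m = 4`), `card_le_ten_of_eRk_eq_four_of_ten` (`|H| ≤ 10` through `cl(H)`).

Imports `Night2T4Facts` (the profile facts, `DFq_four_eq_Nq_of_card_le_add_three`'s pattern) and
`GenQSevenFiveColoopFree` (`SevenFiveTraceSumsCore`, `dem`).
-/
namespace PercRepro.Star

open Finset ThmH SixFour GenQ PerFlat NightThree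

variable {α : Type*} [DecidableEq α] {M : Matroid α} [M.Finite]

/-! ## The trace sum in the profile -/

/-- `Σ_B dem_t(B) = N_q − DF_t`. -/
theorem sum_dem_eq (G : Finset α) (q t : ℕ) :
    ∑ B ∈ Rq M G q, GenQ.dem M G t B = (Nq M G q : ℚ) - (DFq M G q t : ℚ) := by
  rw [Nq_sub_DFq]
  unfold GenQ.dem
  rw [Finset.sum_ite, Finset.sum_const_zero, zero_add, Finset.sum_const, nsmul_eq_mul, mul_one]

/-- **The trace sum at type `t`, times `6`, in the profile**:
`6·TS_t = 7·DF_t + Σ_{k ≤ d} Σ_m #Pc k m · (6(7 − t)/(2 + m) − 7)`. -/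
theorem traceSum_mul_six_eq_profile {H : Finset α} {d : ℕ} (hH : H ⊆ gr M)
    (hrH : M.eRk (H : Set α) = ((4 : ℕ) : ℕ∞)) (hcard : H.card = 4 + d) (t : ℕ) :
    6 * ∑ B ∈ Rq M H 4, ((((4 + 1 : ℕ) : ℚ) + 2 - t) * (1 / (2 + (mTr M B : ℚ))) -
        ((((4 + 1 : ℕ) : ℚ) + 2) / (((4 + 1 : ℕ) : ℚ) + 1)) * GenQ.dem M H t B) =
      7 * (DFq M H 4 t : ℚ) + ∑ k ∈ Finset.range (d + 1), ∑ m ∈ Finset.Icc (mTr M H) 4,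
        ((Pc M H 4 k m).card : ℚ) * (6 * (7 - (t : ℚ)) / (2 + (m : ℚ)) - 7) := by
  have h1 := sum_Rq_eq_sum_Pc hH hrH hcard (fun _ m => 6 * (7 - (t : ℚ)) / (2 + (m : ℚ)) - 7)
  rw [← h1]
  have hdem : ∑ B ∈ Rq M H 4, ((((4 + 1 : ℕ) : ℚ) + 2) / (((4 + 1 : ℕ) : ℚ) + 1)) * GenQ.dem M H t B =
      ((((4 + 1 : ℕ) : ℚ) + 2) / (((4 + 1 : ℕ) : ℚ) + 1)) * ((Nq M H 4 : ℚ) - (DFq M H 4 t : ℚ)) := by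
    rw [← Finset.mul_sum, sum_dem_eq]
  have hN : (Nq M H 4 : ℚ) = ∑ B ∈ Rq M H 4, (1 : ℚ) := by
    unfold Nq
    rw [Finset.card_eq_sum_ones]
    push_cast
    rfl
  have hs3 : ∑ S ∈ Rq M H 4, (6 * (7 - (t : ℚ)) / (2 + (mTr M S : ℚ)) - 7) =
      6 * ∑ B ∈ Rq M H 4, ((((4 + 1 : ℕ) : ℚ) + 2 - t) * (1 / (2 + (mTr M B : ℚ)))) -
        7 * ∑ B ∈ Rq M H 4, (1 : ℚ) := by
    rw [Finset.mul_sum, Finset.mul_sum, ← Finset.sum_sub_distrib]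
    apply Finset.sum_congr rfl
    intro S _
    push_cast
    ring
  rw [Finset.sum_sub_distrib, hdem, hN, hs3]
  ring

/-! ## The demand-free levels at type `2` -/

/-- The sets whose complement has `≤ 1` point are demand-free at type `2`. -/
theorem card_filter_sdiff_le_one_le_DFq (G : Finset α) (q : ℕ) :
    ((Rq M G q).filter (fun S : Finset α => (G \ S).card ≤ 1)).card ≤ DFq M G q 2 := by
  unfold DFq
  apply Finset.card_le_card
  intro S hS
  rw [Finset.mem_filter] at hS ⊢
  refine ⟨hS.1, ?_⟩
  have h1 : M.eRk ((G \ S : Finset α) : Set α) ≤ ((G \ S).card : ℕ∞) := by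
    have := M.eRk_le_encard ((G \ S : Finset α) : Set α)
    rwa [Set.encard_coe_eq_coe_finsetCard] at this
  have h2 : ((G \ S).card : ℕ∞) ≤ (1 : ℕ∞) := by exact_mod_cast hS.2
  calc M.eRk ((G \ S : Finset α) : Set α) + 1 ≤ (1 : ℕ∞) + 1 := by gcongr; exact h1.trans h2
    _ = ((2 : ℕ) : ℕ∞) := by norm_num

/-- The levels `0`, `1` together are at most the sets with a complement of `≤ 1` point. -/
theorem card_two_le_card_filter_le_one (G : Finset α) (q : ℕ) :
    ((Rq M G q).filter (fun S : Finset α => (G \ S).card = 0)).card +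
      ((Rq M G q).filter (fun S : Finset α => (G \ S).card = 1)).card ≤
      ((Rq M G q).filter (fun S : Finset α => (G \ S).card ≤ 1)).card := by
  have hdisj : Disjoint ((Rq M G q).filter (fun S : Finset α => (G \ S).card = 0))
      ((Rq M G q).filter (fun S : Finset α => (G \ S).card = 1)) := by
    rw [Finset.disjoint_filter]
    intro S _ h0 h1
    omega
  have hsub : (Rq M G q).filter (fun S : Finset α => (G \ S).card = 0) ∪
      (Rq M G q).filter (fun S : Finset α => (G \ S).card = 1) ⊆
      (Rq M G q).filter (fun S : Finset α => (G \ S).card ≤ 1) := by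
    intro S hS
    simp only [Finset.mem_union, Finset.mem_filter] at hS ⊢
    rcases hS with ⟨h, h'⟩ | ⟨h, h'⟩ <;> exact ⟨h, by omega⟩
  have := Finset.card_le_card hsub
  rwa [Finset.card_union_of_disjoint hdisj] at this

/-- **The levels `0, 1` are demand-free at type `2`**: `Σ_{k ≤ 1} Σ_m #Pc k m ≤ DF_2`. -/
theorem sum_card_Pc_le_DFq_two {G : Finset α} {q : ℕ} (hG : G ⊆ gr M) (hrG : M.eRk (G : Set α) = (q : ℕ∞)) :
    (∑ m ∈ Finset.Icc (mTr M G) q, (Pc M G q 0 m).card) +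
      (∑ m ∈ Finset.Icc (mTr M G) q, (Pc M G q 1 m).card) ≤ DFq M G q 2 := by
  rw [← card_level_eq_sum_card_Pc hG hrG 0, ← card_level_eq_sum_card_Pc hG hrG 1]
  exact (card_two_le_card_filter_le_one (M := M) G q).trans (card_filter_sdiff_le_one_le_DFq (M := M) G q)

/-! ## Small coranks: every set is demand-free -/

/-- At corank `≤ t − 1` every rank-`4` subset of `H` is demand-free at type `t`, so the trace sum is `≥ 0`
(`t ≤ 7`). -/
theorem traceSum_nonneg_of_card_le {H : Finset α} {t : ℕ} (ht1 : 1 ≤ t) (ht7 : t ≤ 7)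
    (hcard : H.card ≤ 4 + (t - 1)) :
    0 ≤ ∑ B ∈ Rq M H 4, ((((4 + 1 : ℕ) : ℚ) + 2 - t) * (1 / (2 + (mTr M B : ℚ))) -
        ((((4 + 1 : ℕ) : ℚ) + 2) / (((4 + 1 : ℕ) : ℚ) + 1)) * GenQ.dem M H t B) := by
  apply Finset.sum_nonneg
  intro B hB
  have hB' := mem_Rq.1 hB
  have hdem : GenQ.dem M H t B = 0 := by
    unfold GenQ.dem
    rw [if_pos]
    have h1 : 4 ≤ B.card := le_card_of_eRk_eq hB'.2
    have h2 : (H \ B).card = H.card - B.card := Finset.card_sdiff_of_subset hB'.1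
    have h3 : (H \ B).card ≤ t - 1 := by omega
    have h4 : M.eRk ((H \ B : Finset α) : Set α) ≤ ((H \ B).card : ℕ∞) := by
      have := M.eRk_le_encard ((H \ B : Finset α) : Set α)
      rwa [Set.encard_coe_eq_coe_finsetCard] at this
    have h5 : ((H \ B).card : ℕ∞) ≤ ((t - 1 : ℕ) : ℕ∞) := by exact_mod_cast h3
    calc M.eRk ((H \ B : Finset α) : Set α) + 1 ≤ ((t - 1 : ℕ) : ℕ∞) + 1 := by gcongr; exact h4.trans h5
      _ = (t : ℕ∞) := by
        rw [show ((t - 1 : ℕ) : ℕ∞) + 1 = ((t - 1 + 1 : ℕ) : ℕ∞) by push_cast; rfl]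
        congr 1
        omega
  rw [hdem, mul_zero, sub_zero]
  have ht7' : (t : ℚ) ≤ 7 := by exact_mod_cast ht7
  have hm : (0 : ℚ) ≤ mTr M B := by positivity
  have hpos : (0 : ℚ) ≤ 1 / (2 + (mTr M B : ℚ)) := by positivity
  push_cast
  apply mul_nonneg _ hpos
  linarith

/-! ## The sizes of a rank-`4` subset of the core by its coloop count -/

omit [DecidableEq α] in
/-- A set of rank `≤ 1` of a simple matroid has at most one point. -/
theorem card_le_one_of_eRk_le_one (hs : Simple M) {Z : Finset α} (hZ : Z ⊆ gr M)
    (hr : M.eRk (Z : Set α) ≤ 1) : Z.card ≤ 1 := by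
  by_contra h
  push Not at h
  obtain ⟨u, hu, v, hv, huv⟩ := Finset.one_lt_card.1 h
  have h2 := two_le_eRk_of_two_mem hs hZ hu hv huv
  have : (2 : ℕ∞) ≤ 1 := h2.trans hr
  norm_num at this

/-- The cyclic part of a rank-`q` set has rank `q − m` and `|S| − m` points; when that rank is `≤ 1` it has `≤ 1`
point (simple), when it is `2` at most `3` (lines `≤ 3`), when it is `3` at most `6` (planes `≤ 6`). -/
theorem card_le_of_mTr (hs : Simple M) (hline : ∀ L ∈ flatsQ M 2, L.card ≤ 3)
    (hplane : ∀ P ∈ flatsQ M 3, P.card ≤ 6) {H : Finset α} (hH : H ⊆ gr M)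
    (hrH : M.eRk (H : Set α) = ((4 : ℕ) : ℕ∞)) :
    (mTr M H = 1 → H.card ≤ 7) ∧ (mTr M H = 2 → H.card ≤ 5) ∧ (mTr M H = 3 → H.card ≤ 4) ∧
      (mTr M H = 4 → H.card ≤ 5) := by
  have hHR : H ∈ Rq M H 4 := mem_Rq.2 ⟨Finset.Subset.refl _, hrH⟩
  have hZr := eRk_sdiff_coloopsOf_add_mTr hH hHR
  have hZc := card_sdiff_coloopsOf (M := M) H
  have hZg : H \ coloopsOf M H ⊆ gr M := Finset.sdiff_subset.trans hH
  have hZE : ((H \ coloopsOf M H : Finset α) : Set α) ⊆ M.E := by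
    rw [← coe_gr M]
    exact Finset.coe_subset.2 hZg
  have hKH : coloopsOf M H ⊆ H := coloopsOf_subset H
  have hmle : mTr M H ≤ H.card := by
    unfold mTr
    exact Finset.card_le_card hKH
  obtain ⟨r, hr⟩ := exists_eRk_eq_nat (M := M) (H \ coloopsOf M H)
  rw [hr] at hZr
  have hr' : r + mTr M H = 4 := by exact_mod_cast hZr
  -- the flat `cl(Z)` of rank `r`
  have hflat : clF M (H \ coloopsOf M H) ∈ flatsQ M r := by
    rw [mem_flatsQ]
    refine ⟨?_, ?_, ?_⟩
    · intro x hx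
      have hx' : x ∈ M.closure ((H \ coloopsOf M H : Finset α) : Set α) := by
        rw [← coe_clF]
        exact Finset.mem_coe.2 hx
      have := M.closure_subset_ground _ hx'
      rw [← coe_gr M] at this
      exact Finset.mem_coe.1 this
    · rw [coe_clF]
      exact M.isFlat_closure _
    · rw [coe_clF, M.eRk_closure_eq, hr]
  have hsub : H \ coloopsOf M H ⊆ clF M (H \ coloopsOf M H) := by
    intro x hx
    rw [← Finset.mem_coe, coe_clF]
    exact M.subset_closure _ hZE (Finset.mem_coe.2 hx)
  have hZle := Finset.card_le_card hsub
  refine ⟨fun h1 => ?_, fun h2 => ?_, fun h3 => ?_, fun h4 => ?_⟩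
  · have : r = 3 := by omega
    subst this
    have := hplane _ hflat
    omega
  · have : r = 2 := by omega
    subst this
    have := hline _ hflat
    omega
  · have : r = 1 := by omega
    subst this
    have := card_le_one_of_eRk_le_one hs hZg (by rw [hr]; norm_num)
    omega
  · have : r = 0 := by omega
    subst this
    have := card_le_one_of_eRk_le_one hs hZg (by rw [hr]; norm_num)
    omega

omit [DecidableEq α] in
/-- A rank-`4` subset of the core has at most `10` points when its rank-`4` flats have (`H ⊆ cl(H)`). -/
theorem card_le_ten_of_eRk_eq_four_of_ten (h10 : ∀ F ∈ flatsQ M 4, F.card ≤ 10) {H : Finset α}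
    (hH : H ⊆ gr M) (hrH : M.eRk (H : Set α) = ((4 : ℕ) : ℕ∞)) : H.card ≤ 10 := by
  have hHE : (H : Set α) ⊆ M.E := by
    rw [← coe_gr M]
    exact Finset.coe_subset.2 hH
  have hflat : clF M H ∈ flatsQ M 4 := by
    rw [mem_flatsQ]
    refine ⟨?_, ?_, ?_⟩
    · intro x hx
      have hx' : x ∈ M.closure (H : Set α) := by
        rw [← coe_clF]
        exact Finset.mem_coe.2 hx
      have := M.closure_subset_ground _ hx'
      rw [← coe_gr M] at this
      exact Finset.mem_coe.1 this
    · rw [coe_clF]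
      exact M.isFlat_closure _
    · rw [coe_clF, M.eRk_closure_eq, hrH]
  have hsub : H ⊆ clF M H := by
    intro x hx
    rw [← Finset.mem_coe, coe_clF]
    exact M.subset_closure _ hHE (Finset.mem_coe.2 hx)
  exact (Finset.card_le_card hsub).trans (h10 _ hflat)

end PercRepro.Star
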